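import Summits.BirchSwinnertonDyer.Rank1Residual.P2.CMKolyvaginTamagawaIndexOddHeegnerBases
import Summits.BirchSwinnertonDyer.Rank1Residual.X12.CMIsogenyInvariance
import Summits.BirchSwinnertonDyer.Rank1Residual.Additive.QuadraticTwistBSDComparisonIsogeny
import Summits.BirchSwinnertonDyer.Rank1Residual.Partition.MainConjecturesCoveredAllPrimesJetchev
import Literature.NumberTheory.EllipticCurves.ModularDegreeQuadraticTwistProofs
import Literature.NumberTheory.EllipticCurves.ManinConstantQuadraticTwistAtTwoProofs
import Literature.NumberTheory.EllipticCurves.ComplexMultiplicationTwistIsogenyCertProofs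
import Literature.NumberTheory.EllipticCurves.ModularCurveManinSemistableBridgeProofs
import Literature.NumberTheory.EllipticCurves.CuspFormLFunctionLevelConductorProofs
import Literature.NumberTheory.EllipticCurves.IsogenyHasCMIffJMemProofs
import Literature.NumberTheory.EllipticCurves.IsogenyVariableChangeProofs
import Literature.NumberTheory.EllipticCurves.GlobalMinimalModelProofs
import Literature.NumberTheory.EllipticCurves.ManinConstantClassCertificate
import HarnessLib

/-!
# Route `ShiftedKolyvaginAtInertTwo` (leaf `WAllCornerFTwo`), crux `OddManinCMInertTwo`
# (stmt-BirchSwinnertonDyer-25414): the ODD-INERT class REDUCES TO ITS `X₀(N)`-OPTIMAL CURVES, and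
# the per-curve optimality binder is NOT dischargeable — a twist-rigidity no-go (cell
# `bsd-print-cf2`, seat ty2 = discharge interface)

HONEST FRAMING. THEOREMS ONLY — no definition, no named fact, no route file imported, nothing about
BSD asserted or booked; the leaf `Summit.BirchSwinnertonDyer.WAllCornerFTwo`, the crux 25414 and the
class crux `InertOddHeegnerJOfFacts` (stmt-BirchSwinnertonDyer-20672) are OPEN. BSD is not proved by
any of this.

## What is proved, and why

The route's crux `OddManinCMInertTwo` (rev 10) asks, for EVERY globally minimal `W` on the habitat
(CM, `2` inert, `ρ̄_{E,2}` onto, analytic rank `1`), for a parametrisation datum `Dt` of `W` at its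
conductor with the LATTICE CLAUSE `Λ_W = c · Λ_f` (i.e. `W` IS the `X₀(N)`-optimal curve of its class,
`ModularForms.IsOptimalModel`) and `c` odd; and the route's `closes` feeds every curve of the class of
20672 (every twist of `121b1, 361a1, 1849a1, 4489a1, 26569a1`) to that binder. The cell referee
(bsd-print-cf2-ref g6, 2026-08-28) flagged this SUSPECT-FALSE: each habitat isogeny class is a pair
`{E, E^{(−q)}}` (`q = 11, 19, 43, 67, 163`) with ONE optimal member. This file supplies the
kernel-checked interface for the repair and the kernel-checked obstruction:

* §1 `j_eq_of_isIsogenous_of_j_oddHeegner` — on the five odd-Heegner classes the `j`-invariant is a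
  `ℚ`-isogeny invariant (CM field is an isogeny invariant, `X12.cmFieldDiscrOfJ_eq_of_isIsogenous`,
  and the five orders are the only class-number-one orders of their fields, `hasCM_iff_j_mem`).
* §2 `exists_optimalPartner_of_j_oddHeegner` — modulo the modularity fact `exists_isNewformOf` ONLY,
  every globally minimal `W` of the class is `ℚ`-isogenous to a globally minimal `W₀` WITH THE SAME
  `j`, the same analytic rank, and a LATTICE-OPTIMAL datum at its conductor (the tree's theorem
  `Rank1Residual.exists_isIsogenous_optimalDatum_of_modularity`: Eichler–Shimura + Edixhoven 1991
  Prop. 2 + strong multiplicity one, all proved in the tree).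
* §3 `bsdp_of_forall_optimal_of_j_oddHeegner` — THE DISCHARGE INTERFACE: `BSD(W,p)` for every
  globally minimal analytic-rank-one `W` of the class follows from `BSD(W₀,p)` for the OPTIMAL ones
  (those carrying a lattice-optimal datum), by Cassels' isogeny invariance
  (`Additive.TwistComparison.bsdp_of_bsdp_of_isIsogenous`, modulo the three printed facts
  `bsdRHS_eq_of_isIsogenous`, GZK, `hasEntireLFunction_rat` = conjuncts 1–3 of the bundle `𝔅_inert`
  of 20672) — so the repaired crux may carry the optimality of `W` as a HYPOTHESIS
  ("`∀ Dt, Λ_W = c·Λ_f → Odd c`", the 2-part of Manin's conjecture for the optimal curves of these CM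
  classes) and `closes` still concludes the class, by name.
* §4 `isSquare_abs_of_latticeOptimal_quadraticTwist` — TWIST RIGIDITY OF OPTIMALITY: if `W` and a
  model `W' = C • W^{(d)}` of a quadratic twist with the SAME `L`-function both carry lattice-optimal
  data at a common level, then `|d|` is a rational square (`|d| = (u·c/c')²`): the Néron lattice of
  the twist is `u Λ_W/√d` (Pal 2012 Lemma 3.1, `isNeronLatticeOf_quadraticTwist_of_sq_eq`), both
  lattices are integer multiples of the one period lattice `Λ_f` (q-expansion principle), and
  covolumes compare (`PeriodPair.covolume_mulLeft_lattice`).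
* §5 `analyticRank_ne_one_of_oddManin_perCurve` — THE NO-GO: the body of `OddManinCMInertTwo` AS
  TYPED (per-curve optimality on the whole habitat) implies that NO globally minimal curve with one
  of the five odd-Heegner `j`-invariants has analytic rank `1` — the crux empties the class it is
  meant to serve (apply it to `W` and to the minimal model of `W^{(−q)}`, which is `ℚ`-isogenous to
  `W` by CM, `isIsogenous_quadraticTwist_cmFieldDiscr_holds`, hence on the habitat with the same
  analytic rank; §4 then makes the prime `q` a rational square). Unconditional (no fact hypotheses).

* §6 PRINTED DOORS FOR THE REPAIRED CRUX (25414′ = "every lattice-optimal datum has odd `c`",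
  optimality a hypothesis): it holds BY NAME for every globally minimal curve of conductor
  `≤ 300000` (Cremona's table as cited by Česnavičius–Neururer–Saha 2024 §1, modulo the fact
  `cremona_abs_maninConstant_eq_one_of_level_le_300000`), for every class carrying the tree's
  class-local Manin predicate `ModularForms.ClassAbsManinConstantEqOne` (`|c| = 1`), and — file
  `CMKolyvaginHabitatManinAtTwo.lean`, `P2.odd_c_of_isOptimalDatum_of_hasGoodReductionAtPrime_two` —
  on the good-at-2 slice modulo Abbes–Ullmo 1996 Thm. A. What is left of the Manin crux is the
  additive-at-2 twists of conductor `> 300000` without a certificate.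

References: Agashe–Ribet–Stein 2006 §2 (optimal curve, Manin constant); Edixhoven 1991 Prop. 2;
Pal 2012 Lemma 3.1; Milne ADT I.7.3 (Cassels); Silverman ATAEC App. A §3 (the thirteen CM `j`).
-/

noncomputable section

open scoped Classical

open WeierstrassCurve Literature.NumberTheory.EllipticCurves
  Literature.NumberTheory.EllipticCurves.ModularForms

namespace Summit.BirchSwinnertonDyer.Rank1Residual.P2.OptimalPartner

/-! ## §1 The `j`-invariant is an isogeny invariant on the five odd-Heegner classes -/

/-- **On the five odd-Heegner CM classes the `j`-invariant is a `ℚ`-isogeny invariant.** If `W/ℚ`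
has `j(W) ∈ {−2¹⁵, −2¹⁵3³, −2¹⁸3³5³, −2¹⁵3³5³11³, −2¹⁸3³5³23³29³}` (CM by the maximal order of
`ℚ(√−q)`, `q = 11, 19, 43, 67, 163`) and `W₀` is `ℚ`-isogenous to `W`, then `j(W₀) = j(W)`: CM and
the CM field are isogeny invariants (`X12.hasCM_of_isIsogenous`,
`X12.cmFieldDiscrOfJ_eq_of_isIsogenous`), `j(W₀)` is one of the thirteen CM `j`-invariants
(`hasCM_iff_j_mem`), and each of these five fields has a unique class-number-one order.
[cite: SilvermanATAEC1994, App. A §3 (table of CM j-invariants)] -/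
theorem j_eq_of_isIsogenous_of_j_oddHeegner {W W₀ : WeierstrassCurve ℚ} [W.IsElliptic]
    [W₀.IsElliptic] (hiso : IsIsogenous W W₀)
    (hj : W.j = -32768 ∨ W.j = -884736 ∨ W.j = -884736000 ∨ W.j = -147197952000 ∨
      W.j = -262537412640768000) :
    W₀.j = W.j := by
  obtain ⟨hcm, -, -, -⟩ := OddHeegnerTwists.shiftedHabitat_of_j_oddHeegner W hj
  have hcm₀ : W₀.HasCM := X12.hasCM_of_isIsogenous hiso hcm
  have hmem : W₀.j ∈ WeierstrassCurve.cmJInvariants :=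
    (WeierstrassCurve.hasCM_iff_j_mem_holds W₀).mp hcm₀
  have hdisc := X12.cmFieldDiscrOfJ_eq_of_isIsogenous hiso hcm
  simp only [WeierstrassCurve.cmJInvariants, Finset.mem_insert, Finset.mem_singleton] at hmem
  rcases hj with h | h | h | h | h <;> rw [h] at hdisc ⊢ <;>
    rcases hmem with h₀ | h₀ | h₀ | h₀ | h₀ | h₀ | h₀ | h₀ | h₀ | h₀ | h₀ | h₀ | h₀ <;>
    rw [h₀] at hdisc ⊢ <;>
    norm_num [Literature.NumberTheory.EllipticCurves.Rank1Residual.cmFieldDiscrOfJ] at hdisc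

/-! ## §2 The optimal partner (modularity + Edixhoven, by name) -/

/-- **Every curve of the five odd-Heegner classes has an `X₀(N)`-OPTIMAL isogenous partner with the
same `j` and the same analytic rank**, modulo the modularity fact `exists_isNewformOf` only: for
`W/ℚ` globally minimal with one of the five `j`, there is a globally minimal elliptic `W₀`,
`ℚ`-isogenous to `W`, with `j(W₀) = j(W)`, `r_an(W₀) = r_an(W)`, and a parametrisation datum at its
conductor satisfying the lattice clause `Λ_{W₀} = c₀ · Λ_f` (tree theorem
`Rank1Residual.exists_isIsogenous_optimalDatum_of_modularity`; §1; `analyticRank_eq_of_isIsogenous'`).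
[cite: EdixhovenManin1991, Prop. 2] [cite: AgasheRibetStein2006, §2] -/
theorem exists_optimalPartner_of_j_oddHeegner (hnf : exists_isNewformOf)
    (W : WeierstrassCurve ℚ) [W.IsElliptic] [W.IsGloballyMinimal]
    (hj : W.j = -32768 ∨ W.j = -884736 ∨ W.j = -884736000 ∨ W.j = -147197952000 ∨
      W.j = -262537412640768000) :
    ∃ (W₀ : WeierstrassCurve ℚ) (_ : W₀.IsElliptic) (_ : W₀.IsGloballyMinimal)
      (_ : NeZero (W₀.conductorNorm ℤ))
      (Dt : ModularParametrizationData W₀ (W₀.conductorNorm ℤ)),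
      IsIsogenous W₀ W ∧ W₀.j = W.j ∧ W₀.analyticRank = W.analyticRank ∧
        ∀ z ∈ Dt.L.lattice, ∃ w ∈ periodLattice Dt.f, z = (Dt.c : ℂ) * w := by
  obtain ⟨W₀, h₁, h₂, hiso, -, hD⟩ := exists_isIsogenous_optimalDatum_of_modularity hnf W
  haveI := h₁
  haveI := h₂
  haveI : NeZero (W₀.conductorNorm ℤ) := ⟨(W₀.conductorNorm_pos_holds).ne'⟩
  obtain ⟨Dt, hopt⟩ := hD (W₀.conductorNorm ℤ) rfl
  exact ⟨W₀, h₁, h₂, inferInstance, Dt, hiso.symm_of_charZero,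
    j_eq_of_isIsogenous_of_j_oddHeegner hiso hj, (analyticRank_eq_of_isIsogenous' hiso).symm, hopt⟩

/-! ## §3 The discharge interface: the class reduces to its optimal curves -/

/-- **`BSD(·,p)` on the five odd-Heegner classes reduces to the `X₀(N)`-optimal curves.** Modulo
Cassels' isogeny invariance of the BSD quotient (`hCas`), GZK (`hGZK`), the entire `L`-function
(`hL`) — conjuncts 1–3 of the bundle `𝔅_inert` of crux 20672 — and modularity (`hnf`): if `BSD(W₀,p)`
holds for every globally minimal `W₀` of the class of analytic rank `1` CARRYING A LATTICE-OPTIMAL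
DATUM at its conductor (`Λ_{W₀} = c₀·Λ_f`), then `BSD(W,p)` holds for EVERY globally minimal `W` of
the class of analytic rank `1` (§2 + `Additive.TwistComparison.bsdp_of_bsdp_of_isIsogenous`). This is
the shape in which the route's `closes` can take the optimality of `W` as a hypothesis of the Manin
crux. [cite: MilneADT2006, Thm. I.7.3 and Remark I.7.4] [cite: AgasheRibetStein2006, §2] -/
theorem bsdp_of_forall_optimal_of_j_oddHeegner (hCas : bsdRHS_eq_of_isIsogenous)
    (hGZK : rank_eq_analyticRank_of_analyticRank_le_one) (hL : hasEntireLFunction_rat)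
    (hnf : exists_isNewformOf) (p : ℕ) [Fact p.Prime]
    (H : ∀ (W₀ : WeierstrassCurve ℚ) [W₀.IsElliptic] [W₀.IsGloballyMinimal]
      [NeZero (W₀.conductorNorm ℤ)] (Dt : ModularParametrizationData W₀ (W₀.conductorNorm ℤ)),
      (∀ z ∈ Dt.L.lattice, ∃ w ∈ periodLattice Dt.f, z = (Dt.c : ℂ) * w) →
      W₀.analyticRank = 1 →
      (W₀.j = -32768 ∨ W₀.j = -884736 ∨ W₀.j = -884736000 ∨ W₀.j = -147197952000 ∨
        W₀.j = -262537412640768000) → BSDp W₀ p)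
    (W : WeierstrassCurve ℚ) [W.IsElliptic] [W.IsGloballyMinimal] (hr : W.analyticRank = 1)
    (hj : W.j = -32768 ∨ W.j = -884736 ∨ W.j = -884736000 ∨ W.j = -147197952000 ∨
      W.j = -262537412640768000) :
    BSDp W p := by
  obtain ⟨W₀, _, _, _, Dt, hiso, hj₀, hr₀, hopt⟩ := exists_optimalPartner_of_j_oddHeegner hnf W hj
  have hj' : W₀.j = -32768 ∨ W₀.j = -884736 ∨ W₀.j = -884736000 ∨ W₀.j = -147197952000 ∨
      W₀.j = -262537412640768000 := by rw [hj₀]; exact hj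
  have h₀ : BSDp W₀ p := H W₀ Dt hopt (hr₀.trans hr) hj'
  exact Additive.TwistComparison.bsdp_of_bsdp_of_isIsogenous W₀ W p hCas hGZK hL hiso
    (by rw [hr₀, hr]) h₀

/-! ## §4 Twist rigidity of lattice-optimality -/

/-- **A curve and a non-square quadratic twist of it are never both lattice-optimal for one
newform.** Let `D`, `D'` be parametrisation data of `W` and of a model `W' = C • W^{(d)}` (`d ≠ 0`)
at levels `N = N'`, with `aₙ(W) = aₙ(W')` for all `n` (so `D.f = D'.f` by the `q`-expansion
principle). If both satisfy the lattice clause (`Λ_W = c·Λ_f`, `Λ_{W'} = c'·Λ_f`) then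
`(u·c/c')² = |d|` (`u = u(C)`): the Néron lattice of `W'` is `u·Λ_W/√d`
(`isNeronLatticeOf_quadraticTwist_of_sq_eq`, `IsNeronLatticeOf.lattice_eq_mulLeft_of_smul`) and also
`(c'/c)·Λ_W`; compare covolumes (`PeriodPair.covolume_mulLeft_lattice`). In particular `|d|` is a
rational square. [cite: Pal2012, Lemma 3.1 and Remark 2.3] [cite: AgasheRibetStein2006, §2] -/
theorem sq_eq_abs_of_latticeOptimal_quadraticTwist {W W' : WeierstrassCurve ℚ} {N N' : ℕ}
    [NeZero N] [NeZero N'] (D : ModularParametrizationData W N)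
    (D' : ModularParametrizationData W' N') (hNN' : N = N') (hLF : W.LFunction = W'.LFunction)
    (C : VariableChange ℚ) {d : ℚ} (hd : d ≠ 0) (hW' : C • W.quadraticTwist d = W')
    (hopt : ∀ z ∈ D.L.lattice, ∃ w ∈ periodLattice D.f, z = (D.c : ℂ) * w)
    (hopt' : ∀ z ∈ D'.L.lattice, ∃ w ∈ periodLattice D'.f, z = (D'.c : ℂ) * w) :
    ((C.u : ℚ) * D.c / D'.c) ^ 2 = |d| := by
  subst hNN'
  -- one newform
  have hf : D'.f = D.f :=
    eq_of_forall_cuspCoeff_eq_gamma0 fun n ↦ by rw [D'.isNewformOf.2 n, D.isNewformOf.2 n, hLF]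
  -- a square root of `d` in `ℂ`
  obtain ⟨s, hs⟩ := IsAlgClosed.exists_pow_nat_eq ((d : ℚ) : ℂ) zero_lt_two
  have hd0 : ((d : ℚ) : ℂ) ≠ 0 := by exact_mod_cast hd
  have hs0 : s ≠ 0 := by
    rintro rfl
    exact hd0 (by rw [← hs]; simp)
  -- the Néron lattice of `W'` is `u Λ_W / s`
  have hLT := WeierstrassCurve.isNeronLatticeOf_quadraticTwist_of_sq_eq d D.isNeronLattice hs0 hs
  have hD'L : IsNeronLatticeOf ((C • W.quadraticTwist d).baseChange ℂ) D'.L := by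
    rw [hW']; exact D'.isNeronLattice
  have hΛ₁ := IsNeronLatticeOf.lattice_eq_mulLeft_of_smul C hLT hD'L
  have hcov₁ : ZLattice.covolume D'.L.lattice =
      ‖((C.u : ℚ) : ℂ)‖ ^ 2 * (‖s⁻¹‖ ^ 2 * ZLattice.covolume D.L.lattice) := by
    rw [hΛ₁, PeriodPair.covolume_mulLeft_lattice, PeriodPair.covolume_mulLeft_lattice]
  -- the Néron lattice of `W'` is `(c'/c) Λ_W`
  have hc0 := D.cast_c_ne_zero
  have hc0' := D'.cast_c_ne_zero
  have ha0 : (D'.c : ℂ) / (D.c : ℂ) ≠ 0 := div_ne_zero hc0' hc0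
  have hΛ₂ : D'.L.lattice = (D.L.mulLeft ((D'.c : ℂ) / (D.c : ℂ)) ha0).lattice := by
    ext z
    rw [PeriodPair.mem_mulLeft_lattice]
    constructor
    · intro hz
      obtain ⟨w, hw, rfl⟩ := hopt' z hz
      have e : ((D'.c : ℂ) / (D.c : ℂ))⁻¹ * ((D'.c : ℂ) * w) = (D.c : ℂ) * w := by
        field_simp
      rw [e]
      rw [hf] at hw
      exact D.smul_periodLattice_le w hw
    · intro hz
      obtain ⟨w, hw, hw'⟩ := hopt _ hz
      have e : z = (D'.c : ℂ) * w := by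
        have h2 : z = (D'.c : ℂ) / (D.c : ℂ) * ((D.c : ℂ) * w) := by
          rw [← hw', ← mul_assoc, mul_inv_cancel₀ ha0, one_mul]
        rw [h2]
        field_simp
      rw [e]
      rw [← hf] at hw
      exact D'.smul_periodLattice_le w hw
  have hcov₂ : ZLattice.covolume D'.L.lattice =
      ‖(D'.c : ℂ) / (D.c : ℂ)‖ ^ 2 * ZLattice.covolume D.L.lattice := by
    rw [hΛ₂, PeriodPair.covolume_mulLeft_lattice]
  -- norms
  have hu : ‖((C.u : ℚ) : ℂ)‖ = |((C.u : ℚ) : ℝ)| := Complex.norm_ratCast _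
  have hsn : ‖s‖ ^ 2 = |(d : ℝ)| := by
    rw [← norm_pow, hs, Complex.norm_ratCast]
  have hsi : ‖s⁻¹‖ ^ 2 = |(d : ℝ)|⁻¹ := by rw [norm_inv, inv_pow, hsn]
  have hca : ‖(D'.c : ℂ) / (D.c : ℂ)‖ = |(D'.c : ℝ)| / |(D.c : ℝ)| := by
    rw [norm_div, Complex.norm_intCast, Complex.norm_intCast]
  rw [hu, hsi] at hcov₁
  rw [hca] at hcov₂
  have hcov0 : ZLattice.covolume D.L.lattice ≠ 0 := (ZLattice.covolume_pos _ _).ne'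
  have key : |((C.u : ℚ) : ℝ)| ^ 2 * |(d : ℝ)|⁻¹ = (|(D'.c : ℝ)| / |(D.c : ℝ)|) ^ 2 := by
    have h := hcov₁.symm.trans hcov₂
    rw [← mul_assoc] at h
    exact mul_right_cancel₀ hcov0 h
  have hdR : |(d : ℝ)| ≠ 0 := abs_ne_zero.mpr (by exact_mod_cast hd)
  have hcZ : D.c ≠ 0 := fun h ↦ hc0 (by rw [h, Int.cast_zero])
  have hcZ' : D'.c ≠ 0 := fun h ↦ hc0' (by rw [h, Int.cast_zero])
  have hcR : (D.c : ℝ) ≠ 0 := by exact_mod_cast hcZ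
  have hcR' : (D'.c : ℝ) ≠ 0 := by exact_mod_cast hcZ'
  have key' : (((C.u : ℚ) : ℝ) * (D.c : ℝ) / (D'.c : ℝ)) ^ 2 = |(d : ℝ)| := by
    rw [sq_abs, div_pow, sq_abs, sq_abs] at key
    field_simp at key
    field_simp
    linarith [key]
  have : (((((C.u : ℚ) * D.c / D'.c) ^ 2 : ℚ)) : ℝ) = ((|d| : ℚ) : ℝ) := by
    push_cast
    exact key'
  exact_mod_cast this

/-- **Corollary: `|d|` is a rational square.** [cite: Pal2012, Lemma 3.1 and Remark 2.3] -/
theorem isSquare_abs_of_latticeOptimal_quadraticTwist {W W' : WeierstrassCurve ℚ} {N N' : ℕ}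
    [NeZero N] [NeZero N'] (D : ModularParametrizationData W N)
    (D' : ModularParametrizationData W' N') (hNN' : N = N') (hLF : W.LFunction = W'.LFunction)
    (C : VariableChange ℚ) {d : ℚ} (hd : d ≠ 0) (hW' : C • W.quadraticTwist d = W')
    (hopt : ∀ z ∈ D.L.lattice, ∃ w ∈ periodLattice D.f, z = (D.c : ℂ) * w)
    (hopt' : ∀ z ∈ D'.L.lattice, ∃ w ∈ periodLattice D'.f, z = (D'.c : ℂ) * w) :
    IsSquare |d| :=
  ⟨(C.u : ℚ) * D.c / D'.c, by
    rw [← sq]; exact (sq_eq_abs_of_latticeOptimal_quadraticTwist D D' hNN' hLF C hd hW' hopt hopt').symm⟩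

/-! ## §5 The no-go: per-curve optimality empties the odd-inert class -/

/-- The CM discriminant on the five odd-Heegner `j`-invariants is `−q` with `q` a prime, so its
absolute value is not a rational square. [cite: SilvermanATAEC1994, App. A §3 (first table)] -/
theorem not_isSquare_abs_cmFieldDiscr_of_j_oddHeegner {j : ℚ}
    (hj : j = -32768 ∨ j = -884736 ∨ j = -884736000 ∨ j = -147197952000 ∨
      j = -262537412640768000) :
    ¬ IsSquare |((cmFieldDiscr j : ℤ) : ℚ)| := by
  rcases hj with h | h | h | h | h <;> rw [h] <;> norm_num [cmFieldDiscr]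

/-- **THE NO-GO (per-curve optimality is not dischargeable on the habitat).** Suppose — this is the
body of crux `OddManinCMInertTwo` (stmt-BirchSwinnertonDyer-25414) as typed at route rev 10 — that
EVERY globally minimal `W/ℚ` with CM, `2` inert in the CM field, `ρ̄_{E,2}` onto and analytic rank
`1` admits a parametrisation datum at its conductor with `Λ_W = c·Λ_f` and `c` odd. Then NO globally
minimal curve with one of the five odd-Heegner `j`-invariants has analytic rank `1`: for such a `W`,
the minimal model `W'` of the twist `W^{(d_K)}` (`d_K = −q`) is `ℚ`-isogenous to `W`
(`isIsogenous_quadraticTwist_cmFieldDiscr_holds`, Milne 1972 / Burungale–Flach 2024), so it has the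
same `j` (§1), lies on the habitat (`OddHeegnerTwists.shiftedHabitat_of_j_oddHeegner`) and has
analytic rank `1` (`analyticRank_eq_of_isIsogenous'`); both `W` and `W'` would be lattice-optimal for
the one newform (levels agree by strong multiplicity one, `IsNewformOf.level_eq_level`), and §4
makes the prime `q` a rational square. So the crux as typed is vacuous on exactly the class the route
serves; the optimality of `W` must be a HYPOTHESIS of the Manin crux (§3 routes the class through
it). Unconditional. [cite: AgasheRibetStein2006, §2] [cite: Pal2012, Lemma 3.1 and Remark 2.3]
[cite: BurungaleFlach2024, proof of Cor. 2 (arXiv p. 4)] -/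
theorem analyticRank_ne_one_of_oddManin_perCurve
    (hMan : ∀ (W : WeierstrassCurve ℚ) [W.IsElliptic] [W.IsGloballyMinimal]
      [NeZero (W.conductorNorm ℤ)], W.HasCM →
      Literature.NumberTheory.EllipticCurves.Rank1Residual.CMInert W 2 →
      W.HasSurjectiveModNGaloisRep (2 : ℤ) → W.analyticRank = 1 →
      ∃ Dt : ModularParametrizationData W (W.conductorNorm ℤ),
        (∀ z ∈ Dt.L.lattice, ∃ w ∈ periodLattice Dt.f, z = (Dt.c : ℂ) * w) ∧ Odd Dt.c)
    (W : WeierstrassCurve ℚ) [W.IsElliptic] [W.IsGloballyMinimal]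
    (hj : W.j = -32768 ∨ W.j = -884736 ∨ W.j = -884736000 ∨ W.j = -147197952000 ∨
      W.j = -262537412640768000) :
    W.analyticRank ≠ 1 := by
  intro hr
  haveI : NeZero (W.conductorNorm ℤ) := ⟨(W.conductorNorm_pos_holds).ne'⟩
  obtain ⟨hcm, hin, hρ, -⟩ := OddHeegnerTwists.shiftedHabitat_of_j_oddHeegner W hj
  obtain ⟨Dt, hopt, -⟩ := hMan W hcm hin hρ hr
  -- the CM twist partner
  have hjmax : W.j ∈ maximalCMJInvariants := by
    rcases hj with h | h | h | h | h <;> rw [h] <;>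
      simp only [maximalCMJInvariants, Finset.mem_insert, Finset.mem_singleton] <;> norm_num
  have hdisc0 : ((cmFieldDiscr W.j : ℤ) : ℚ) ≠ 0 := by exact_mod_cast (cmFieldDiscr_neg hjmax).ne
  haveI hT : (W.quadraticTwist ((cmFieldDiscr W.j : ℤ) : ℚ)).IsElliptic :=
    W.isElliptic_quadraticTwist hdisc0
  obtain ⟨C, hC⟩ := hasGlobalMinimalModel_rat_holds (W.quadraticTwist ((cmFieldDiscr W.j : ℤ) : ℚ))
  haveI := hC
  have hisoT : IsIsogenous W (W.quadraticTwist ((cmFieldDiscr W.j : ℤ) : ℚ)) :=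
    isIsogenous_quadraticTwist_cmFieldDiscr_holds W hjmax
  have hiso : IsIsogenous W (C • W.quadraticTwist ((cmFieldDiscr W.j : ℤ) : ℚ)) :=
    hisoT.trans' (isIsogenous_smul _ C)
  have hj' := j_eq_of_isIsogenous_of_j_oddHeegner hiso hj
  have hjW' : (C • W.quadraticTwist ((cmFieldDiscr W.j : ℤ) : ℚ)).j = -32768 ∨
      (C • W.quadraticTwist ((cmFieldDiscr W.j : ℤ) : ℚ)).j = -884736 ∨
      (C • W.quadraticTwist ((cmFieldDiscr W.j : ℤ) : ℚ)).j = -884736000 ∨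
      (C • W.quadraticTwist ((cmFieldDiscr W.j : ℤ) : ℚ)).j = -147197952000 ∨
      (C • W.quadraticTwist ((cmFieldDiscr W.j : ℤ) : ℚ)).j = -262537412640768000 := by
    rw [hj']; exact hj
  have hr' : (C • W.quadraticTwist ((cmFieldDiscr W.j : ℤ) : ℚ)).analyticRank = 1 := by
    rw [← analyticRank_eq_of_isIsogenous' hiso]; exact hr
  haveI : NeZero ((C • W.quadraticTwist ((cmFieldDiscr W.j : ℤ) : ℚ)).conductorNorm ℤ) :=
    ⟨((C • W.quadraticTwist ((cmFieldDiscr W.j : ℤ) : ℚ)).conductorNorm_pos_holds).ne'⟩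
  obtain ⟨hcm', hin', hρ', -⟩ :=
    OddHeegnerTwists.shiftedHabitat_of_j_oddHeegner (C • W.quadraticTwist _) hjW'
  obtain ⟨Dt', hopt', -⟩ := hMan (C • W.quadraticTwist _) hcm' hin' hρ' hr'
  have hN : W.conductorNorm ℤ = (C • W.quadraticTwist ((cmFieldDiscr W.j : ℤ) : ℚ)).conductorNorm ℤ :=
    IsNewformOf.level_eq_level Dt.isNewformOf (Dt'.isNewformOf.of_isIsogenous hiso)
  exact not_isSquare_abs_cmFieldDiscr_of_j_oddHeegner hj
    (isSquare_abs_of_latticeOptimal_quadraticTwist Dt Dt' hN hiso.LFunction_eq C hdisc0 rfl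
      hopt hopt')

/-! ## §6 Printed doors for the repaired crux ("every lattice-optimal datum has odd `c`") -/

/-- `|c| = 1 ⟹ c` odd, for the Manin constant of a parametrisation datum (`maninConstant = c`).
[cite: AgasheRibetStein2006, §2] -/
theorem odd_c_of_abs_maninConstant_eq_one {W : WeierstrassCurve ℚ} {N : ℕ} [NeZero N]
    (Dt : ModularParametrizationData W N) (h : |Dt.maninConstant| = 1) : Odd Dt.c := by
  have h' : |Dt.c| = 1 := h
  rcases (abs_eq (zero_le_one' ℤ)).mp h' with h1 | h1 <;> rw [h1] <;> decide

/-- **Door 1 (Cremona ≤ 300000, by name).** Modulo the fact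
`cremona_abs_maninConstant_eq_one_of_level_le_300000` (Cremona's table: every `X₀(N)`-optimal curve
of conductor `≤ 300000` has Manin constant `1`, as cited by Česnavičius–Neururer–Saha 2024 §1):
for a globally minimal `W` with `N_W ≤ 300000`, EVERY lattice-optimal datum at the conductor has odd
`c` — the repaired Manin crux 25414′ on that range, with no habitat hypothesis at all.
[cite: CesnaviciusNeururerSaha2023, §1] [cite: Cremona2022ManinConstants, ¶ "Concerning the Manin constant"] -/
theorem odd_c_of_latticeOptimal_of_conductorNorm_le_300000
    (h3 : cremona_abs_maninConstant_eq_one_of_level_le_300000)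
    (W : WeierstrassCurve ℚ) [W.IsElliptic] [W.IsGloballyMinimal] [NeZero (W.conductorNorm ℤ)]
    (hN : W.conductorNorm ℤ ≤ 300000)
    (Dt : ModularParametrizationData W (W.conductorNorm ℤ))
    (hopt : ∀ z ∈ Dt.L.lattice, ∃ w ∈ periodLattice Dt.f, z = (Dt.c : ℂ) * w) : Odd Dt.c :=
  odd_c_of_abs_maninConstant_eq_one Dt (h3 W Dt hopt hN)

/-- **Door 2 (class certificate).** If the isogeny class of `W` carries the tree's class-local
Manin predicate `ClassAbsManinConstantEqOne W` ("the optimal curve of the class has `c = ±1`", the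
shape of one row of Cremona's table / of a modular-symbol certificate), then every lattice-optimal
datum of the globally minimal `W` (any level) has odd `c`. [cite: AgasheRibetStein2006, §2 and appendix Thm. 5.2] -/
theorem odd_c_of_latticeOptimal_of_classAbsManinConstantEqOne {W : WeierstrassCurve ℚ}
    [W.IsElliptic] [W.IsGloballyMinimal] (h : ClassAbsManinConstantEqOne W) {N : ℕ} [NeZero N]
    (Dt : ModularParametrizationData W N)
    (hopt : ∀ z ∈ Dt.L.lattice, ∃ w ∈ periodLattice Dt.f, z = (Dt.c : ℂ) * w) : Odd Dt.c :=
  odd_c_of_abs_maninConstant_eq_one Dt (h W Dt (isIsogenous_of_smul_eq (one_smul _ W)) hopt)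

/-- **The repaired crux holds BY NAME on the habitat below conductor `300000`** (shape of 25414′
with the extra binder `N_W ≤ 300000`; the habitat hypotheses are not even used), modulo Cremona's
fact. [cite: CesnaviciusNeururerSaha2023, §1] -/
theorem oddManin_latticeOptimal_of_conductorNorm_le_300000
    (h3 : cremona_abs_maninConstant_eq_one_of_level_le_300000) :
    ∀ (W : WeierstrassCurve ℚ) [W.IsElliptic] [W.IsGloballyMinimal] [NeZero (W.conductorNorm ℤ)],
      W.conductorNorm ℤ ≤ 300000 → W.HasCM →
      Literature.NumberTheory.EllipticCurves.Rank1Residual.CMInert W 2 →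
      W.HasSurjectiveModNGaloisRep (2 : ℤ) → W.analyticRank = 1 →
      ∀ (Dt : ModularParametrizationData W (W.conductorNorm ℤ)),
        (∀ z ∈ Dt.L.lattice, ∃ w ∈ periodLattice Dt.f, z = (Dt.c : ℂ) * w) → Odd Dt.c :=
  fun W _ _ _ hN _ _ _ _ Dt hopt ↦ odd_c_of_latticeOptimal_of_conductorNorm_le_300000 h3 W hN Dt hopt

end Summit.BirchSwinnertonDyer.Rank1Residual.P2.OptimalPartner

end
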